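import Literature.MathematicalPhysics.QuantumFieldTheory.Balaban1983to89.B12TreeDecay
import Summits.QuantumFields.Balaban3D.Proofs.Representation33

/-!
# Bałaban CMP 102 (1985) 255–275, d = 3 — prover seat p6 (lane `pub-balaban3d`): the NEWBORN SLICE of (46) at the
# chart level — the size of the order-2…6 jets of (30)/(33)/(60)/(61) from the Cauchy estimates of the chart binder
# G3D-01 and the bound (28), summed over the localizations INSIDE a region with the tree-decay sum of (25)
# (CARRIER-PARAMETRIC; lane ruling R-46N, owner p6)

Source: T. Bałaban, Commun. Math. Phys. **102** (1985) 255–275 [Balaban1985UV3] (= [B10]).  p. 264 L18–20 «Thus we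
obtain expressions which are polynomials in B of at least the second order, and at most the sixth order»; (34)
p. 264 «n ≥ 2»; p. 267 L7–15 «By the assumption n ≥ 2, summation over all Y_j with y fixed yields for g_{k−1}
sufficiently small (45) … Summation over y gives the factor (M₁L^jη)^{−3}|Λ_k|, and finally summation over j = 1,
…, k gives the following bound for the sum of interaction terms in (41), (46) Σ_{j=1}^{k} Σ_{Y_j} |𝒫_j(Y_j, U_k)| ≤
O(1)M₁^{…}g²_{k−1}p²(g_{k−1})|Λ_k|. Thus the sum is not only convergent, but also small. Of course the condition
n ≥ 2 plays a crucial role in the above bounds»; p. 265 L14–16 (the (61)-born terms) «identical to the expression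
on the right-hand side of (33), only the coefficients do not depend on g₀».

HONEST FRAMING (lane PLAN.md §0).  [B10] proves UV stability of the d = 3 lattice gauge theory on a finite torus —
NOT a continuum limit, NOT infinite volume, NOT a mass gap, NOT d = 4, NOT Clay.  Nothing of the paper is asserted
here: this file is [folklore] calculus over the lane's (α) chart inputs — WHAT THE INPUTS OF THE REPRESENTATION
LEAVES C5/C7 GIVE for the terms BORN at step k (the retained order-2…6 jets of the perturbative pieces (33)/(60) and
of the (63)-pieces (61)), which enter the interaction sum `Pint (k+1) = PoldIn_k + PY_k + PYZ_k` of (41)_{k+1}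
(seat p1's `Carriers.withSeries_Pint_succ`) and hence the lane's leaf B15 `LeafSystem.bound46` at level k + 1
(seat p2's `Bound46Series.abs_pint_succ_le` / `bound46_series_of_steps`, old slice + this newborn slice).  THE CURRENCY IS EXACT: per localization X the jet is
bounded by `5·M_X·(2s/ρ)²` (Cauchy's inequality on the half-ball of G3D-01, `s = cB·r(g_k)g_kp(g_k)` the sup form
of (28) p. 263), so the (61)-born terms (g-FREE amplitude `C63`, p. 265 L15) come with `(r(g_k)g_kp(g_k))²`, i.e.
print's `g_k²p(g_k)²` of (46) TIMES `r(g_k)² = (1 + log g_k⁻¹)^{2r₀}`; print reaches (46) through the DISTANCE form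
of (28) «|B(c)| < 4L²|c₋ − y|g₀p(g₀)» and the bond-localized kernels of (34)/(43)/(44), structure the lane's chart
data do not carry (recorded as a FINDING in the lane STATUS, 2026-08-22, seat p6; the lead rules the repair).  The
perturbative pieces (amplitude `C25·g_k` of (25)) reach print's currency by the tangent-line lemma
`B10.rpow_mul_exp_neg_le` (`g·r(g)² ≤ (2r₀)^{2r₀}e^{1−2r₀}`).
PLACEMENT: lane cell topic `Summits/QuantumFields/Balaban3D/Proofs/`.  Record: HOME `run/shared/lean/pub/pub-balaban3d/`.
-/

noncomputable section

open scoped Topology Nat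
open Metric Set Finset
open Literature.MathematicalPhysics.QuantumFieldTheory.Balaban1983to89
open Literature.MathematicalPhysics.QuantumFieldTheory.Balaban1983to89.B10
open Literature.MathematicalPhysics.QuantumFieldTheory.Balaban1983to89.B10SectAGathering (pFun_pow rFun_mul_pFun_pow)
open Literature.MathematicalPhysics.QuantumFieldTheory.Balaban1983to89.B12TreeDecay (CubeSystem kappa₀ K₀ K₀_pos)
open Literature.MathematicalPhysics.QuantumFieldTheory.Balaban1985CMP102.Binders
  (ChartAnalyticityAsCited FarTermsDecayAsCited)
open Summit.QuantumFields.Balaban3D.Proofs.Representation33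

namespace Summit.QuantumFields.Balaban3D.Proofs.NewbornJet

/-! ## §1 The size of the order-2…6 jet (Cauchy's inequality on the half-ball) -/

section Jet

variable {E : Type*} [NormedAddCommGroup E] [NormedSpace ℂ E] [FiniteDimensional ℂ E]
  {F : Type*} [NormedAddCommGroup F] [NormedSpace ℂ F] [CompleteSpace F]

/-- **The order-2…6 jet of (30) is of the SECOND order in the chart configuration** (p. 264 L18–20 «polynomials in
B of at least the second order, and at most the sixth order»; (34) «n ≥ 2»): if `Ψ` is holomorphic on `ball 0 ρ`
and bounded by `M` on `closedBall 0 (ρ/2)` (the lane's GAP binder G3D-01) and `‖B‖ ≤ s ≤ ρ/4`, then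
`‖jet26 Ψ B‖ ≤ 5·M·(2s/ρ)²` — each of the five Taylor terms of orders 2, …, 6 is at most `M(2s/ρ)ⁿ ≤ M(2s/ρ)²` by
Cauchy's inequality (`Literature.Analysis.Complex.norm_taylorCoeff_le`) and `2s/ρ ≤ ½`.  No use of (32): the jet
does not contain the first-order term. [cite: Balaban1985UV3, (30) p.263 + (34) p.264] -/
theorem norm_jet26_le {Ψ : E → F} {ρ M s : ℝ} (hρ : 0 < ρ)
    (hΨ : DifferentiableOn ℂ Ψ (ball 0 ρ)) (hM : ∀ z ∈ closedBall (0 : E) (ρ / 2), ‖Ψ z‖ ≤ M)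
    (hs : 0 ≤ s) (hsρ : s ≤ ρ / 4) {B : E} (hB : ‖B‖ ≤ s) :
    ‖jet26 Ψ B‖ ≤ 5 * M * (2 * s / ρ) ^ 2 := by
  have hM0 : 0 ≤ M := (norm_nonneg _).trans (hM 0 (mem_closedBall_self (by positivity)))
  rcases hs.eq_or_lt with hs0 | hs'
  · subst hs0
    have hB0 : B = 0 := norm_le_zero_iff.1 hB
    subst hB0
    rw [jet26_apply_zero, norm_zero]
    positivity
  have hq0 : 0 ≤ 2 * s / ρ := by positivity
  have hq1 : 2 * s / ρ ≤ 1 := by rw [div_le_iff₀ hρ]; linarith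
  have hy : B ∈ closedBall (0 : E) s := by simpa using hB
  have hterm : ∀ n ∈ Finset.Ico 2 7,
      ‖(n ! : ℂ)⁻¹ • iteratedFDeriv ℂ n Ψ 0 (fun _ => B)‖ ≤ M * (2 * s / ρ) ^ 2 := by
    intro n hn
    have hn2 : 2 ≤ n := (Finset.mem_Ico.1 hn).1
    have h := Literature.Analysis.Complex.norm_taylorCoeff_le (c := (0 : E)) hΨ hs'
      (by linarith : s < ρ / 2) (by linarith : ρ / 2 < ρ) hM hy n
    simp only [sub_zero] at h
    have hq : M / (ρ / 2 / s) ^ n = M * (2 * s / ρ) ^ n := by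
      rw [div_eq_mul_inv M, ← inv_pow]
      congr 2
      field_simp
    rw [hq] at h
    exact h.trans (mul_le_mul_of_nonneg_left (pow_le_pow_of_le_one hq0 hq1 hn2) hM0)
  calc ‖jet26 Ψ B‖ ≤ ∑ n ∈ Finset.Ico 2 7, ‖(n ! : ℂ)⁻¹ • iteratedFDeriv ℂ n Ψ 0 (fun _ => B)‖ :=
        norm_sum_le _ _
    _ ≤ ∑ _n ∈ Finset.Ico 2 7, M * (2 * s / ρ) ^ 2 := Finset.sum_le_sum hterm
    _ = 5 * M * (2 * s / ρ) ^ 2 := by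
        rw [Finset.sum_const, Nat.card_Ico, nsmul_eq_mul]; norm_num; ring

/-- The same for the real part, in the form used per localization: `|Re jet26 Ψ B| ≤ 5·M·(2s/ρ)²`. [folklore] -/
theorem abs_re_jet26_le {Ψ : E → ℂ} {ρ M s : ℝ} (hρ : 0 < ρ)
    (hΨ : DifferentiableOn ℂ Ψ (ball 0 ρ)) (hM : ∀ z ∈ closedBall (0 : E) (ρ / 2), ‖Ψ z‖ ≤ M)
    (hs : 0 ≤ s) (hsρ : s ≤ ρ / 4) {B : E} (hB : ‖B‖ ≤ s) :
    |(jet26 Ψ B).re| ≤ 5 * M * (2 * s / ρ) ^ 2 :=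
  (Complex.abs_re_le_norm _).trans (norm_jet26_le hρ hΨ hM hs hsρ hB)

end Jet

/-! ## §2 (25) summed over the localizations INSIDE a region: `Σ_{X ⊆ Ω} M_X ≤ C·K₀·#Ω` -/

section Inside

/-- **(25)-type amplitudes summed over the localizations INSIDE a finite region of big blocks** (p. 267 L10
«Summation over y gives the factor (M₁L^jη)^{−3}|Λ_k|»; p. 264 L23–25 «We use the remaining exp(−κ𝓛(X)) to control
a sum over all X»): over the cube carriers of `B12TreeDecay` (wall degree ≤ Δ, volume leaf c₀, κ ≥ κ₀(c₀, Δ)),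
nonnegative per-domain sizes `M X ≤ C·e^{−κ𝓛(X)}` summed over any family of domains whose blocks lie in `Ω` give
`≤ C·K₀(c₀, Δ)·#Ω` — Dimock's anchored form of (1.26), LQB `B12TreeDecay.ineq126_touches` (every domain inside `Ω`
touches `Ω`: it has a block). [cite: Balaban1985UV3, (46) p.267 + (25) p.262] -/
theorem sum_le_of_inside {S : LocDomainSys} (G : CubeSystem S) {Δ : ℕ} {c₀ κ C : ℝ} (hΔ : G.DegreeLE Δ)
    (hV : G.VolumeLeaf c₀) (hκ : kappa₀ c₀ Δ ≤ κ) (hC : 0 ≤ C) (M : S.Dom → ℝ) (hM0 : ∀ X, 0 ≤ M X)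
    (hM : ∀ X, M X ≤ C * Real.exp (-(κ * S.dj X))) (Ω : Finset G.Cube) (loc : Finset S.Dom)
    (hloc : ∀ X ∈ loc, G.cubes X ⊆ Ω) :
    ∑ X ∈ loc, M X ≤ C * K₀ c₀ Δ * Ω.card := by
  have hsub : loc ⊆ Finset.univ.filter (fun X => (G.cubes X ∩ Ω).Nonempty) := by
    intro X hX
    rw [Finset.mem_filter]
    refine ⟨Finset.mem_univ _, ?_⟩
    rw [Finset.inter_eq_left.2 (hloc X hX)]
    exact (G.connected X).1
  have h126 := B12TreeDecay.ineq126_touches G hΔ hV hκ Ω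
  calc ∑ X ∈ loc, M X ≤ ∑ X ∈ Finset.univ.filter (fun X => (G.cubes X ∩ Ω).Nonempty), M X :=
        Finset.sum_le_sum_of_subset_of_nonneg hsub fun X _ _ => hM0 X
    _ ≤ ∑ X ∈ Finset.univ.filter (fun X => (G.cubes X ∩ Ω).Nonempty), C * Real.exp (-κ * S.dj X) :=
        Finset.sum_le_sum fun X _ => by rw [neg_mul]; exact hM X
    _ = C * ∑ X ∈ Finset.univ.filter (fun X => (G.cubes X ∩ Ω).Nonempty), Real.exp (-κ * S.dj X) := by
        rw [Finset.mul_sum]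
    _ ≤ C * (K₀ c₀ Δ * Ω.card) := mul_le_mul_of_nonneg_left h126 hC
    _ = C * K₀ c₀ Δ * Ω.card := by ring

end Inside

/-! ## §3 The newborn terms of one family of charts, summed over the retained localizations -/

section Newborn

variable {S : LocDomainSys} {E : Type} [NormedAddCommGroup E] [NormedSpace ℂ E] [FiniteDimensional ℂ E]

/-- **The retained order-2…6 terms of one chart family, summed** («Summing up terms with the same monomial in B», p.
271 L9; (46) p. 267): for charts `Ψ X` obeying G3D-01 `ChartAnalyticityAsCited (Ψ X) ρ (M X)` with `M X ≤
C·e^{−κ𝓛(X)}`, chart configurations with `‖B X‖ ≤ s ≤ ρ/4` ((28) and its smallness), far monomials under G3D-06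
`FarTermsDecayAsCited far M Cfar c`, and retained localizations whose blocks lie inside `Ω`,
`|Σ_{X ∈ loc} (Re jet26 (Ψ X) (B X) − far X h U)| ≤ (20(s/ρ)² + Cfar·c)·C·K₀(c₀,Δ)·#Ω` — `abs_re_jet26_le` per
domain, then `sum_le_of_inside`. [cite: Balaban1985UV3, (46) p.267 + (30) p.263 + p.271 L9] -/
theorem abs_sum_jet_sub_far_le (G : CubeSystem S) {Δ : ℕ} {c₀ κ C : ℝ} (hΔ : G.DegreeLE Δ)
    (hV : G.VolumeLeaf c₀) (hκ : kappa₀ c₀ Δ ≤ κ) (hC : 0 ≤ C) {H Cfg : Type*}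
    (Ψ : S.Dom → E → ℂ) (M : S.Dom → ℝ) {ρ s Cfar c : ℝ}
    (chart : ∀ X, ChartAnalyticityAsCited (Ψ X) ρ (M X)) (hM : ∀ X, M X ≤ C * Real.exp (-(κ * S.dj X)))
    (B : S.Dom → H → Cfg → E) (hs : 0 ≤ s) (hsρ : s ≤ ρ / 4) (hB : ∀ X h U, ‖B X h U‖ ≤ s)
    (far : S.Dom → H → Cfg → ℝ) (far_le : FarTermsDecayAsCited far M Cfar c) (hc : 0 ≤ Cfar * c)
    (Ω : Finset G.Cube) (loc : Finset S.Dom) (hloc : ∀ X ∈ loc, G.cubes X ⊆ Ω) (h : H) (U : Cfg) :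
    |∑ X ∈ loc, ((jet26 (Ψ X) (B X h U)).re - far X h U)|
      ≤ (20 * (s / ρ) ^ 2 + Cfar * c) * (C * K₀ c₀ Δ * Ω.card) := by
  have hM0 : ∀ X, 0 ≤ M X := fun X => (chart X).bound_nonneg
  have hcoef : 0 ≤ 20 * (s / ρ) ^ 2 + Cfar * c := by positivity
  have hper : ∀ X ∈ loc, |(jet26 (Ψ X) (B X h U)).re - far X h U| ≤ (20 * (s / ρ) ^ 2 + Cfar * c) * M X := by
    intro X _
    have hρ : 0 < ρ := (chart X).1
    have hj := abs_re_jet26_le hρ (chart X).2.1 (chart X).2.2 hs hsρ (hB X h U)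
    have hf : |far X h U| ≤ Cfar * (M X * c) := far_le X h U
    have hq : 5 * M X * (2 * s / ρ) ^ 2 = 20 * (s / ρ) ^ 2 * M X := by ring
    calc |(jet26 (Ψ X) (B X h U)).re - far X h U|
        ≤ |(jet26 (Ψ X) (B X h U)).re| + |far X h U| := abs_sub _ _
      _ ≤ 20 * (s / ρ) ^ 2 * M X + Cfar * (M X * c) := by rw [← hq]; exact add_le_add hj hf
      _ = (20 * (s / ρ) ^ 2 + Cfar * c) * M X := by ring
  calc |∑ X ∈ loc, ((jet26 (Ψ X) (B X h U)).re - far X h U)|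
      ≤ ∑ X ∈ loc, |(jet26 (Ψ X) (B X h U)).re - far X h U| := Finset.abs_sum_le_sum_abs _ _
    _ ≤ ∑ X ∈ loc, (20 * (s / ρ) ^ 2 + Cfar * c) * M X := Finset.sum_le_sum hper
    _ = (20 * (s / ρ) ^ 2 + Cfar * c) * ∑ X ∈ loc, M X := by rw [Finset.mul_sum]
    _ ≤ (20 * (s / ρ) ^ 2 + Cfar * c) * (C * K₀ c₀ Δ * Ω.card) :=
        mul_le_mul_of_nonneg_left (sum_le_of_inside G hΔ hV hκ hC M hM0 hM Ω loc hloc) hcoef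

end Newborn

/-! ## §4 The d = 3 power counting of the newborn currency (tangent-line lemma) -/

section PowerCounting

/-- The tangent-line constant `(q/c)^q·e^{c−q}` of `B10.rpow_mul_exp_neg_le`: the best constant in `g^c·(1 + log
g⁻¹)^q ≤ const` on `(0, 1]`. [folklore] -/
def tlConst (q c : ℝ) : ℝ := (q / c) ^ q * Real.exp (c - q)

/-- `0 ≤ tlConst q c` for `q, c > 0`. [folklore] -/
theorem tlConst_nonneg {q c : ℝ} (hq : 0 < q) (hc : 0 < c) : 0 ≤ tlConst q c := by
  unfold tlConst; positivity

/-- **`g^c·(1 + log g⁻¹)^q ≤ (q/c)^q e^{c−q}` on `(0, 1]`** (real exponents `q, c > 0`): the tangent-line lemma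
`B10.rpow_mul_exp_neg_le` with `u = log g⁻¹`, `g^c = e^{−cu}` — the shape of every «O(1)·g^a·p(g)^b·r(g)^c ≤ O(1)»
of the d = 3 power counting (Sect. D p. 272 «O(1)M₁³g²p²|Λ_k| ≤ O(1)|T₁^{(k)}|», LQB `B10.gsq_psq_le`). [cite: Balaban1985UV3, Sect. D p.272] -/
theorem rpow_mul_logpow_le (q c g : ℝ) (hq : 0 < q) (hc : 0 < c) (hg : 0 < g) (hg1 : g ≤ 1) :
    g ^ c * (1 + Real.log g⁻¹) ^ q ≤ tlConst q c := by
  have hu := log_inv_nonneg_of_le_one hg hg1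
  have hcore := rpow_mul_exp_neg_le q c (Real.log g⁻¹) hq hc (by linarith)
  have hgc : g ^ c = Real.exp (-(c * Real.log g⁻¹)) := by
    rw [Real.log_inv, Real.rpow_def_of_pos hg]; congr 1; ring
  rw [hgc, mul_comm]
  exact hcore

/-- `r(g)^n = (1 + log g⁻¹)^{n r₀}` for `0 < g ≤ 1` (`B10.rFun`). [folklore] -/
theorem rFun_pow (r₀ g : ℝ) (n : ℕ) (hg : 0 < g) (hg1 : g ≤ 1) :
    rFun r₀ g ^ n = (1 + Real.log g⁻¹) ^ ((n : ℝ) * r₀) := by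
  have hu := log_inv_nonneg_of_le_one hg hg1
  unfold rFun
  rw [mul_comm (n : ℝ) r₀, Real.rpow_mul (by linarith), Real.rpow_natCast]

/-- **The perturbative newborn currency is print's**: `g³·r(g)²·p(g)² ≤ tlConst(2r₀, 1)·g²p(g)²` on `(0, 1]` for `r₀ > 0`
(one factor `g` of the amplitude (25) absorbs `r(g)²`). [cite: Balaban1985UV3, (46) p.267] -/
theorem gcube_rsq_psq_le (r₀ b₀ p₀ g : ℝ) (hr₀ : 0 < r₀) (hg : 0 < g) (hg1 : g ≤ 1) :
    g ^ 3 * rFun r₀ g ^ 2 * pFun b₀ p₀ g ^ 2 ≤ tlConst (2 * r₀) 1 * (g ^ 2 * pFun b₀ p₀ g ^ 2) := by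
  have hcore := rpow_mul_logpow_le (2 * r₀) 1 g (by linarith) one_pos hg hg1
  rw [Real.rpow_one] at hcore
  have hr2 : rFun r₀ g ^ 2 = (1 + Real.log g⁻¹) ^ (2 * r₀) := by
    rw [rFun_pow r₀ g 2 hg hg1]; norm_num
  have hp2 : 0 ≤ g ^ 2 * pFun b₀ p₀ g ^ 2 := by positivity
  calc g ^ 3 * rFun r₀ g ^ 2 * pFun b₀ p₀ g ^ 2
      = (g * (1 + Real.log g⁻¹) ^ (2 * r₀)) * (g ^ 2 * pFun b₀ p₀ g ^ 2) := by rw [hr2]; ring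
    _ ≤ tlConst (2 * r₀) 1 * (g ^ 2 * pFun b₀ p₀ g ^ 2) := mul_le_mul_of_nonneg_right hcore hp2

/-- **The seventh-order far currency with one amplitude factor `g` is print's**: `g⁸(r(g)p(g))⁷ ≤ b₀⁵·tlConst(7r₀ +
5p₀, 6)·g²p(g)²` on `(0, 1]` (`g⁸(rp)⁷ = g²p²·b₀⁵·g⁶(1 + log g⁻¹)^{7r₀+5p₀}`). [cite: Balaban1985UV3, (46) p.267 + (30) p.263] -/
theorem g8_rp7_le (r₀ b₀ p₀ g : ℝ) (hq : 0 < 7 * r₀ + 5 * p₀) (hb₀ : 0 ≤ b₀) (hg : 0 < g) (hg1 : g ≤ 1) :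
    g ^ 8 * (rFun r₀ g * pFun b₀ p₀ g) ^ 7
      ≤ b₀ ^ 5 * tlConst (7 * r₀ + 5 * p₀) 6 * (g ^ 2 * pFun b₀ p₀ g ^ 2) := by
  have hu := log_inv_nonneg_of_le_one hg hg1
  have h1u : 0 < 1 + Real.log g⁻¹ := by linarith
  have hcore := rpow_mul_logpow_le (7 * r₀ + 5 * p₀) 6 g hq (by norm_num) hg hg1
  have hsplit : g ^ 8 * (rFun r₀ g * pFun b₀ p₀ g) ^ 7
      = b₀ ^ 5 * (g ^ (6 : ℝ) * (1 + Real.log g⁻¹) ^ (7 * r₀ + 5 * p₀)) * (g ^ 2 * pFun b₀ p₀ g ^ 2) := by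
    have h7 := rFun_mul_pFun_pow r₀ b₀ p₀ g 7 hg hg1
    have hp2 := pFun_pow b₀ p₀ g 2 hg hg1
    rw [h7, hp2, show ((6 : ℝ)) = ((6 : ℕ) : ℝ) by norm_num, Real.rpow_natCast]
    have hexp : (1 + Real.log g⁻¹) ^ ((7 : ℕ) * (r₀ + p₀) : ℝ)
        = (1 + Real.log g⁻¹) ^ (7 * r₀ + 5 * p₀) * (1 + Real.log g⁻¹) ^ (((2 : ℕ) : ℝ) * p₀) := by
      rw [← Real.rpow_add h1u]; congr 1; push_cast; ring
    rw [hexp]; ring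
  have hrest : 0 ≤ b₀ ^ 5 := pow_nonneg hb₀ 5
  have hp2 : 0 ≤ g ^ 2 * pFun b₀ p₀ g ^ 2 := by positivity
  rw [hsplit]
  exact mul_le_mul_of_nonneg_right (mul_le_mul_of_nonneg_left hcore hrest) hp2

/-- The (61)-born far currency WITHOUT an amplitude factor: `g⁷(r(g)p(g))⁷ ≤ b₀⁵·tlConst(5r₀ + 5p₀, 5)·(r(g)g p(g))²`
on `(0, 1]` (`g⁷(rp)⁷ = (rgp)²·b₀⁵·g⁵(1 + log g⁻¹)^{5r₀+5p₀}`). [cite: Balaban1985UV3, (46) p.267 + (30) p.263] -/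
theorem g7_rp7_le (r₀ b₀ p₀ g : ℝ) (hq : 0 < 5 * r₀ + 5 * p₀) (hb₀ : 0 ≤ b₀) (hg : 0 < g) (hg1 : g ≤ 1) :
    g ^ 7 * (rFun r₀ g * pFun b₀ p₀ g) ^ 7
      ≤ b₀ ^ 5 * tlConst (5 * r₀ + 5 * p₀) 5 * (rFun r₀ g * g * pFun b₀ p₀ g) ^ 2 := by
  have hu := log_inv_nonneg_of_le_one hg hg1
  have h1u : 0 < 1 + Real.log g⁻¹ := by linarith
  have hcore := rpow_mul_logpow_le (5 * r₀ + 5 * p₀) 5 g hq (by norm_num) hg hg1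
  have hsplit : g ^ 7 * (rFun r₀ g * pFun b₀ p₀ g) ^ 7
      = b₀ ^ 5 * (g ^ (5 : ℝ) * (1 + Real.log g⁻¹) ^ (5 * r₀ + 5 * p₀))
          * (rFun r₀ g * g * pFun b₀ p₀ g) ^ 2 := by
    have h7 := rFun_mul_pFun_pow r₀ b₀ p₀ g 7 hg hg1
    have h2 : (rFun r₀ g * g * pFun b₀ p₀ g) ^ 2 = g ^ 2 * (rFun r₀ g * pFun b₀ p₀ g) ^ 2 := by ring
    have h2' := rFun_mul_pFun_pow r₀ b₀ p₀ g 2 hg hg1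
    rw [h2, h2', h7, show ((5 : ℝ)) = ((5 : ℕ) : ℝ) by norm_num, Real.rpow_natCast]
    have hexp : (1 + Real.log g⁻¹) ^ ((7 : ℕ) * (r₀ + p₀) : ℝ)
        = (1 + Real.log g⁻¹) ^ (5 * r₀ + 5 * p₀) * (1 + Real.log g⁻¹) ^ (((2 : ℕ) : ℝ) * (r₀ + p₀)) := by
      rw [← Real.rpow_add h1u]; congr 1; push_cast; ring
    rw [hexp]; ring
  have hrest : 0 ≤ b₀ ^ 5 := pow_nonneg hb₀ 5
  have hp2 : 0 ≤ (rFun r₀ g * g * pFun b₀ p₀ g) ^ 2 := sq_nonneg _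
  rw [hsplit]
  exact mul_le_mul_of_nonneg_right (mul_le_mul_of_nonneg_left hcore hrest) hp2

end PowerCounting

end Summit.QuantumFields.Balaban3D.Proofs.NewbornJet

end
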